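import Summits.KontsevichZagierPeriods.KontsevichZagierPeriods.Theorems.VietaFibreKernelFormCut
import Summits.KontsevichZagierPeriods.KontsevichZagierPeriods.Theorems.FurushoPentagonKernelModuloPeriodConjectureSectorKernelOfFormalSpan
import HarnessLib

/-!
# Crux `KernelForm` (stmt-KontsevichZagierPeriods-10447), line `Sketch`: the SECTOR FORM of the crux
# (Conjecture 1 on a finitely generated sector ⟺ formal rank = numerical rank)

`KernelForm := ∀ c, KZ.eval c = 0 → c ∈ KZ.relations` (Conjecture 1 in kernel form for the calculus of
`KZCalculus.lean`; shared item of routes VietaFibre / OctahedralSymmetry) is fed by SECTOR routes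
(OctahedralSymmetry itself, FurushoPentagon, GenusOneIterated, Grothendieck, …): for a finite family
`w : κ → KZ.FormalRep` they prove that enough `ℤ`-linear relations among the `w k` are move chains
(a *certificate*) and import a transcendence statement about the VALUES `KZ.eval (w k)` (a basis /
dimension statement). This file states once how the two inputs combine to the crux on the sector,
and that the crux is the conjunction of its finite sectors. Notation: `P := KZ.FormalPeriodRing`,
`P_ℚ := KZ.FormalPeriodAlgebra = ℚ ⊗_ℤ P`, `ψ c := KZ.toPeriodAlgebra (KZ.toFormalPeriod c)` (so
`ψ c = 0 ↔ c ∈ relations`, since `P ↪ P_ℚ` by integer division), `F(w) := span_ℚ {ψ (w k)}` (FORMAL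
span), `V(w) := span_ℚ {eval (w k)} ⊆ ℝ` (NUMERICAL span); `evalPQ` maps `F(w)` onto `V(w)`.

* `sectorKernel_of_span_of_linearIndependent` — `w` formally spans the sector `⟨v⟩` and the values
  `eval (w k)` are `ℚ`-linearly independent ⟹ Conjecture 1 on `⟨v⟩` (general form of FurushoPentagon's
  `stub_sectorKernelOfFormalSpan`); `sectorKernel_of_zsmul_sub_mem_of_linearIndependent`: the same
  with integer certificates `n • v i − Σ m_k • w k ∈ relations`.
* `linearIndependent_toPeriodAlgebra_of_linearIndependent_eval` (unconditional: independent values ⟹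
  independent classes); `linearIndependent_eval_iff_of_sectorKernel` (⟺ on a sector with the crux).
* RANK FORM `sectorKernel_iff_finrank_eq` — finite `w`: Conjecture 1 on `⟨w⟩ ⟺ finrank F(w) =
  finrank V(w)`; unconditionally `finrank V(w) ≤ finrank F(w)` (`finrank_span_eval_le`).
* CERTIFICATE ARITHMETIC `finrank_span_add_le_card_of_relations` (`r` independent integer relations
  that are move chains ⟹ `finrank F(w) + r ≤ N`) and `sectorKernel_of_certificate` (move rank `≥ r`,
  numerical rank `≥ d`, `N ≤ r + d` ⟹ Conjecture 1 on the sector).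
* `kernelForm_iff_forall_finset` — `KernelForm ⟺ ∀` finite `S ⊆ FormalRep`, `finrank span ψ(S) =
  finrank span eval(S)`; OctahedralSymmetry twins.

Nothing conjecture-grade is claimed. References: M. Kontsevich, D. Zagier, *Periods* (2001), §1.2,
§4.1; F. Brown, Ann. of Math. 175 (2012), Thm 1.1 (model instance: Hoffman spanning); Mathlib
(`LinearIndependent.iff_fractionRing`, `IsLocalization.exist_integer_multiples`, rank–nullity).
-/

noncomputable section

namespace Summit.KontsevichZagierPeriods.KernelForm.LocaliseAtValuePrime

open Literature.NumberTheory.Transcendental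
open Summit.KontsevichZagierPeriods.FurushoPentagon.KernelModuloPeriodConjecture
  (sectorKernel_toPeriodAlgebra_injective)
open Module

/-! ### The universal realisation `ψ = toPeriodAlgebra ∘ toFormalPeriod : FormalRep → P_ℚ` -/

/-- `ψ` as a bundled additive map. [folklore] -/
theorem exists_psi : ∃ ψ : KZ.FormalRep →+ KZ.FormalPeriodAlgebra,
    ∀ c : KZ.FormalRep, ψ c = KZ.toPeriodAlgebra (KZ.toFormalPeriod c) :=
  ⟨(KZ.toPeriodAlgebra : KZ.FormalPeriodRing →ₐ[ℤ] KZ.FormalPeriodAlgebra).toRingHom.toAddMonoidHom.comp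
      (KZ.toFormalPeriod : KZ.FormalRep →ₙ+* KZ.FormalPeriodRing).toAddMonoidHom, fun _ => rfl⟩

/-- **`ψ c = 0 ↔ c ∈ relations`**: `P ↪ P_ℚ` (integer division is a derived rule, FurushoPentagon's
proved `IntegerDivision`, packaged as `sectorKernel_toPeriodAlgebra_injective`) and `⟦c⟧ = 0 ↔ c ∈
relations`. [Kontsevich–Zagier 2001, §1.2] -/
theorem toPeriodAlgebra_toFormalPeriod_eq_zero_iff {c : KZ.FormalRep} :
    KZ.toPeriodAlgebra (KZ.toFormalPeriod c) = 0 ↔ c ∈ KZ.relations := by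
  rw [← KZ.toFormalPeriod_eq_zero_iff]
  exact ⟨fun h => sectorKernel_toPeriodAlgebra_injective (by rw [h, map_zero]),
    fun h => by rw [h, map_zero]⟩

/-- `evalPQ (ψ c) = eval c`. [folklore] -/
theorem evalPQ_toPeriodAlgebra_toFormalPeriod (c : KZ.FormalRep) :
    KZ.evalPQ (KZ.toPeriodAlgebra (KZ.toFormalPeriod c)) = KZ.eval c := by rw [KZ.evalPQ_toPeriodAlgebra, KZ.evalP_toFormalPeriod]

/-- The sector generated by a family is mapped by `ψ` into the formal span `F(w)`. [folklore] -/
theorem toPeriodAlgebra_toFormalPeriod_mem_span {κ : Type*} (w : κ → KZ.FormalRep) {c : KZ.FormalRep}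
    (hc : c ∈ AddSubgroup.closure (Set.range w)) :
    KZ.toPeriodAlgebra (KZ.toFormalPeriod c) ∈
      Submodule.span ℚ (Set.range fun k => KZ.toPeriodAlgebra (KZ.toFormalPeriod (w k))) := by
  obtain ⟨ψ, hψ⟩ := exists_psi
  have hle : AddSubgroup.closure (Set.range w) ≤
      (Submodule.span ℚ (Set.range fun k => KZ.toPeriodAlgebra (KZ.toFormalPeriod (w k)))).toAddSubgroup.comap ψ := by
    rw [AddSubgroup.closure_le]
    rintro _ ⟨k, rfl⟩
    rw [SetLike.mem_coe, AddSubgroup.mem_comap, Submodule.mem_toAddSubgroup, hψ]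
    exact Submodule.subset_span ⟨k, rfl⟩
  have h := hle hc
  rwa [AddSubgroup.mem_comap, Submodule.mem_toAddSubgroup, hψ] at h

/-- `evalPQ` maps the formal span `F(w)` onto the numerical span `V(w)`. [folklore] -/
theorem map_evalPQ_span {κ : Type*} (w : κ → KZ.FormalRep) :
    Submodule.map KZ.evalPQ.toLinearMap
        (Submodule.span ℚ (Set.range fun k => KZ.toPeriodAlgebra (KZ.toFormalPeriod (w k)))) =
      Submodule.span ℚ (Set.range fun k => KZ.eval (w k)) := by
  have h : (⇑KZ.evalPQ.toLinearMap ∘ fun k => KZ.toPeriodAlgebra (KZ.toFormalPeriod (w k))) =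
      fun k => KZ.eval (w k) :=
    funext fun k => by
      simp only [Function.comp_apply, AlgHom.toLinearMap_apply, evalPQ_toPeriodAlgebra_toFormalPeriod]
  rw [LinearMap.map_span, ← Set.range_comp, h]

/-! ### Spanning sub-family with independent values ⟹ Conjecture 1 on the sector -/

/-- **Sector kernel from formal spanning and numerical independence** (the general form of
FurushoPentagon's `stub_sectorKernelOfFormalSpan`). Let `v` generate a sector and let `w` be a family
such that every `ψ (v i)` is a `ℚ`-combination of the `ψ (w k)` in `P_ℚ` (formal spanning — what move
certificates give) and the real numbers `eval (w k)` are `ℚ`-linearly independent (the transcendence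
input). Then every `ℤ`-combination `c` of the `v i` with `eval c = 0` lies in `KZ.relations`: expand
`ψ c` on the `ψ (w k)`, evaluate, kill the coefficients by independence, pull back along `P ↪ P_ℚ`.
[Kontsevich–Zagier 2001, §1.2; Brown 2012, Thm 1.1 (model instance)] -/
theorem sectorKernel_of_span_of_linearIndependent {ι κ : Type*} (v : ι → KZ.FormalRep)
    (w : κ → KZ.FormalRep)
    (hspan : ∀ i, KZ.toPeriodAlgebra (KZ.toFormalPeriod (v i)) ∈
      Submodule.span ℚ (Set.range fun k => KZ.toPeriodAlgebra (KZ.toFormalPeriod (w k))))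
    (hind : LinearIndependent ℚ fun k => KZ.eval (w k)) :
    ∀ c ∈ AddSubgroup.closure (Set.range v), KZ.eval c = 0 → c ∈ KZ.relations := by
  intro c hc hev
  obtain ⟨ψ, hψ⟩ := exists_psi
  -- `ψ c` lies in the formal span of the `w k`
  have hcH : ψ c ∈ Submodule.span ℚ (Set.range fun k => KZ.toPeriodAlgebra (KZ.toFormalPeriod (w k))) := by
    have hle : AddSubgroup.closure (Set.range v) ≤
        (Submodule.span ℚ (Set.range fun k => KZ.toPeriodAlgebra (KZ.toFormalPeriod (w k)))).toAddSubgroup.comap ψ := by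
      rw [AddSubgroup.closure_le]
      rintro _ ⟨i, rfl⟩
      rw [SetLike.mem_coe, AddSubgroup.mem_comap, Submodule.mem_toAddSubgroup, hψ]
      exact hspan i
    exact hle hc
  obtain ⟨q, hq⟩ := (Finsupp.mem_span_range_iff_exists_finsupp).1 hcH
  -- evaluate: `eval c = Σ_k q_k · eval (w k)`
  have hq0 : KZ.evalPQ (ψ c) = Finsupp.linearCombination ℚ (fun k => KZ.eval (w k)) q := by
    rw [← hq, Finsupp.linearCombination_apply, map_finsuppSum]
    exact Finsupp.sum_congr fun t _ => by rw [map_smul, evalPQ_toPeriodAlgebra_toFormalPeriod]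
  have hev' : KZ.evalPQ (ψ c) = 0 := by rw [hψ, evalPQ_toPeriodAlgebra_toFormalPeriod, hev]
  -- independence kills the coefficients
  have hq1 : q = 0 := linearIndependent_iff.1 hind q (by rw [← hq0, hev'])
  have hψc : KZ.toPeriodAlgebra (KZ.toFormalPeriod c) = 0 := by
    rw [← hψ, ← hq, hq1, Finsupp.sum_zero_index]
  exact toPeriodAlgebra_toFormalPeriod_eq_zero_iff.mp hψc

/-- **Sector kernel from integer certificates and numerical independence** — the same, with the
formal spanning given in the calculus: for each generator `v i` an integer `n ≠ 0` and integers `m_k`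
with `n • v i − Σ_k m_k • w k ∈ KZ.relations` (a move chain). [Kontsevich–Zagier 2001, §1.2] -/
theorem sectorKernel_of_zsmul_sub_mem_of_linearIndependent {ι κ : Type*} (v : ι → KZ.FormalRep)
    (w : κ → KZ.FormalRep)
    (hspan : ∀ i, ∃ n : ℤ, n ≠ 0 ∧ ∃ f : κ →₀ ℤ, n • v i - f.sum (fun k m => m • w k) ∈ KZ.relations)
    (hind : LinearIndependent ℚ fun k => KZ.eval (w k)) :
    ∀ c ∈ AddSubgroup.closure (Set.range v), KZ.eval c = 0 → c ∈ KZ.relations := by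
  refine sectorKernel_of_span_of_linearIndependent v w (fun i => ?_) hind
  obtain ⟨n, hn, f, hf⟩ := hspan i
  obtain ⟨ψ, hψ⟩ := exists_psi
  have h1 : (n : ℚ) • ψ (v i) = f.sum fun k m => (m : ℚ) • ψ (w k) := by
    have h := toPeriodAlgebra_toFormalPeriod_eq_zero_iff.mpr hf
    rw [← hψ, map_sub, sub_eq_zero, map_zsmul, map_finsuppSum] at h
    rw [Int.cast_smul_eq_zsmul, h]
    exact Finsupp.sum_congr fun k _ => by rw [map_zsmul, Int.cast_smul_eq_zsmul]
  have h2 : ψ (v i) = (n : ℚ)⁻¹ • f.sum fun k m => (m : ℚ) • ψ (w k) := by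
    rw [← h1, smul_smul, inv_mul_cancel₀ (by exact_mod_cast hn), one_smul]
  rw [← hψ, h2, Finsupp.sum]
  refine Submodule.smul_mem _ _ (sum_mem fun k _ => Submodule.smul_mem _ _ ?_)
  rw [hψ]
  exact Submodule.subset_span ⟨k, rfl⟩

/-! ### Independence of values versus independence of formal classes -/

/-- **Independent values ⟹ independent classes** (unconditional): `evalPQ ∘ ψ = eval` is linear.
[Kontsevich–Zagier 2001, §4.1] -/
theorem linearIndependent_toPeriodAlgebra_of_linearIndependent_eval {κ : Type*} (w : κ → KZ.FormalRep)
    (hind : LinearIndependent ℚ fun k => KZ.eval (w k)) :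
    LinearIndependent ℚ fun k => KZ.toPeriodAlgebra (KZ.toFormalPeriod (w k)) := by
  have h : (⇑KZ.evalPQ.toLinearMap ∘ fun k => KZ.toPeriodAlgebra (KZ.toFormalPeriod (w k))) =
      fun k => KZ.eval (w k) :=
    funext fun k => by
      simp only [Function.comp_apply, AlgHom.toLinearMap_apply, evalPQ_toPeriodAlgebra_toFormalPeriod]
  refine LinearIndependent.of_comp KZ.evalPQ.toLinearMap ?_
  rw [h]
  exact hind

/-- **On a sector where Conjecture 1 holds, independence of values ⟺ independence of formal
classes.** (⟸): a rational relation among the values is, after clearing denominators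
(`LinearIndependent.iff_fractionRing`, `ℚ = Frac ℤ`), an integer combination `c` of the `w k` with
`eval c = 0`, hence a relation, hence `ψ c = 0`, a relation among the classes.
[Kontsevich–Zagier 2001, §1.2, §4.1] -/
theorem linearIndependent_eval_iff_of_sectorKernel {κ : Type*} (w : κ → KZ.FormalRep)
    (hK : ∀ c ∈ AddSubgroup.closure (Set.range w), KZ.eval c = 0 → c ∈ KZ.relations) :
    LinearIndependent ℚ (fun k => KZ.eval (w k)) ↔
      LinearIndependent ℚ fun k => KZ.toPeriodAlgebra (KZ.toFormalPeriod (w k)) := by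
  refine ⟨linearIndependent_toPeriodAlgebra_of_linearIndependent_eval w, fun h => ?_⟩
  rw [← LinearIndependent.iff_fractionRing ℤ ℚ, linearIndependent_iff']
  intro s g hg k hk
  obtain ⟨ψ, hψ⟩ := exists_psi
  have hc : (∑ i ∈ s, g i • w i) ∈ AddSubgroup.closure (Set.range w) :=
    AddSubgroup.sum_mem _ fun i _ => AddSubgroup.zsmul_mem _ (AddSubgroup.subset_closure (Set.mem_range_self i)) _
  have hev : KZ.eval (∑ i ∈ s, g i • w i) = 0 := by
    rw [map_sum]
    simpa only [map_zsmul] using hg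
  have h0 : ∑ i ∈ s, (g i : ℚ) • KZ.toPeriodAlgebra (KZ.toFormalPeriod (w i)) = 0 := by
    have h1 := toPeriodAlgebra_toFormalPeriod_eq_zero_iff.mpr (hK _ hc hev)
    rw [← hψ, map_sum] at h1
    rw [← h1]
    exact Finset.sum_congr rfl fun i _ => by rw [map_zsmul, Int.cast_smul_eq_zsmul, hψ]
  exact_mod_cast linearIndependent_iff'.1 h s (fun i => (g i : ℚ)) h0 k hk

/-! ### The rank form on a finite sector -/

/-- **Numerical rank ≤ formal rank** (unconditional): `V(w)` is the image of `F(w)` under `evalPQ`.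
[Kontsevich–Zagier 2001, §4.1] -/
theorem finrank_span_eval_le {κ : Type*} [Finite κ] (w : κ → KZ.FormalRep) :
    finrank ℚ (Submodule.span ℚ (Set.range fun k => KZ.eval (w k))) ≤
      finrank ℚ (Submodule.span ℚ (Set.range fun k => KZ.toPeriodAlgebra (KZ.toFormalPeriod (w k)))) := by
  haveI := Module.Finite.span_of_finite ℚ
    (Set.finite_range fun k => KZ.toPeriodAlgebra (KZ.toFormalPeriod (w k)))
  rw [← map_evalPQ_span]
  exact Submodule.finrank_map_le _ _

/-- On a sector where Conjecture 1 holds, `evalPQ` is injective on `F(w)`: clearing denominators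
(`IsLocalization.exist_integer_multiples`), `b • x = ψ c` with `c` an integer combination of the `w k`
of value `0`, hence a relation, so `ψ c = 0` and `x = 0`. [Kontsevich–Zagier 2001, §1.2, §4.1] -/
theorem evalPQ_eq_zero_imp_of_sectorKernel {κ : Type*} (w : κ → KZ.FormalRep)
    (hK : ∀ c ∈ AddSubgroup.closure (Set.range w), KZ.eval c = 0 → c ∈ KZ.relations)
    {x : KZ.FormalPeriodAlgebra}
    (hx : x ∈ Submodule.span ℚ (Set.range fun k => KZ.toPeriodAlgebra (KZ.toFormalPeriod (w k))))
    (h0 : KZ.evalPQ x = 0) : x = 0 := by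
  obtain ⟨ψ, hψ⟩ := exists_psi
  obtain ⟨q, rfl⟩ := (Finsupp.mem_span_range_iff_exists_finsupp).1 hx
  -- clear denominators of the coefficients `q k`, `k ∈ q.support`
  obtain ⟨b, hb⟩ := IsLocalization.exist_integer_multiples (nonZeroDivisors ℤ) q.support q
  choose! m hm using hb
  have hb0 : ((b : ℤ) : ℚ) ≠ 0 := by exact_mod_cast nonZeroDivisors.coe_ne_zero b
  -- `b • x = ψ c` with `c := Σ_k m_k • w k`
  set c : KZ.FormalRep := ∑ k ∈ q.support, m k • w k with hc_def
  have hc : c ∈ AddSubgroup.closure (Set.range w) :=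
    AddSubgroup.sum_mem _ fun k _ => AddSubgroup.zsmul_mem _ (AddSubgroup.subset_closure (Set.mem_range_self k)) _
  have hbx : ((b : ℤ) : ℚ) • (q.sum fun k a => a • KZ.toPeriodAlgebra (KZ.toFormalPeriod (w k))) = ψ c := by
    rw [hc_def, map_sum, Finsupp.sum, Finset.smul_sum]
    refine Finset.sum_congr rfl fun k hk => ?_
    rw [map_zsmul, hψ, smul_smul, ← Int.cast_smul_eq_zsmul ℚ (m k)]
    congr 1
    have h := hm k hk
    rw [zsmul_eq_mul] at h
    rw [← h]
    simp
  -- `eval c = b · evalPQ x = 0`, so `c` is a relation and `b • x = ψ c = 0`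
  have hev : KZ.eval c = 0 := by
    rw [← evalPQ_toPeriodAlgebra_toFormalPeriod, ← hψ, ← hbx, map_smul, h0, smul_zero]
  have hψc : ψ c = 0 := by rw [hψ]; exact toPeriodAlgebra_toFormalPeriod_eq_zero_iff.mpr (hK c hc hev)
  rw [hψc, smul_eq_zero] at hbx
  exact hbx.resolve_left hb0

/-- **RANK FORM of Conjecture 1 on a finite sector**: for a finite family `w` of formal combinations,
every `ℤ`-combination of the `w k` of value `0` is a relation **iff** the formal span
`F(w) = span_ℚ ψ(w) ⊆ P_ℚ` and the numerical span `V(w) = span_ℚ eval(w) ⊆ ℝ` have the same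
dimension ("formal rank = numerical rank"; `evalPQ : F(w) → V(w)` is onto, and it is injective iff
the crux holds on the sector). [Kontsevich–Zagier 2001, §1.2, §4.1] -/
theorem sectorKernel_iff_finrank_eq {κ : Type*} [Finite κ] (w : κ → KZ.FormalRep) :
    (∀ c ∈ AddSubgroup.closure (Set.range w), KZ.eval c = 0 → c ∈ KZ.relations) ↔
      finrank ℚ (Submodule.span ℚ (Set.range fun k => KZ.toPeriodAlgebra (KZ.toFormalPeriod (w k)))) =
        finrank ℚ (Submodule.span ℚ (Set.range fun k => KZ.eval (w k))) := by
  set F := Submodule.span ℚ (Set.range fun k => KZ.toPeriodAlgebra (KZ.toFormalPeriod (w k))) with hF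
  set V := Submodule.span ℚ (Set.range fun k => KZ.eval (w k)) with hV
  haveI : Module.Finite ℚ F := Module.Finite.span_of_finite ℚ (Set.finite_range _)
  haveI : Module.Finite ℚ V := Module.Finite.span_of_finite ℚ (Set.finite_range _)
  -- the restriction `f : F → V` of `evalPQ`, onto
  have hfV : ∀ x : F, KZ.evalPQ.toLinearMap x ∈ V := fun x => by
    rw [hV, ← map_evalPQ_span w]
    exact Submodule.mem_map_of_mem x.2
  set f : F →ₗ[ℚ] V := (KZ.evalPQ.toLinearMap.domRestrict F).codRestrict V hfV with hf
  have hf_apply : ∀ x : F, (f x : ℝ) = KZ.evalPQ x := fun x => rfl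
  have hf_surj : Function.Surjective f := by
    rintro ⟨y, hy⟩
    rw [hV, ← map_evalPQ_span w] at hy
    obtain ⟨x, hx, rfl⟩ := hy
    exact ⟨⟨x, hx⟩, Subtype.ext rfl⟩
  constructor
  · intro hK
    have hf_inj : Function.Injective f := by
      rw [← LinearMap.ker_eq_bot, LinearMap.ker_eq_bot']
      rintro ⟨x, hx⟩ h
      have h' : KZ.evalPQ x = 0 := by
        rw [← hf_apply ⟨x, hx⟩, h]; rfl
      exact Subtype.ext (evalPQ_eq_zero_imp_of_sectorKernel w hK hx h')
    exact LinearEquiv.finrank_eq (LinearEquiv.ofBijective f ⟨hf_inj, hf_surj⟩)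
  · intro heq c hc hev
    have hf_inj : Function.Injective f :=
      (LinearMap.injective_iff_surjective_of_finrank_eq_finrank heq).2 hf_surj
    have hcF : KZ.toPeriodAlgebra (KZ.toFormalPeriod c) ∈ F := toPeriodAlgebra_toFormalPeriod_mem_span w hc
    have h0 : f ⟨_, hcF⟩ = 0 := by
      refine Subtype.ext ?_
      rw [hf_apply]
      simpa only [Submodule.coe_zero, ZeroMemClass.coe_zero] using
        (evalPQ_toPeriodAlgebra_toFormalPeriod c).trans hev
    have h1 : (⟨_, hcF⟩ : F) = 0 := hf_inj (h0.trans (map_zero f).symm)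
    exact toPeriodAlgebra_toFormalPeriod_eq_zero_iff.mp (congrArg Subtype.val h1)

/-- **Rank criterion**: `finrank F(w) ≤ finrank V(w)` gives Conjecture 1 on the sector. [KZ 2001, §1.2] -/
theorem sectorKernel_of_finrank_le {κ : Type*} [Finite κ] (w : κ → KZ.FormalRep)
    (h : finrank ℚ (Submodule.span ℚ (Set.range fun k => KZ.toPeriodAlgebra (KZ.toFormalPeriod (w k)))) ≤
      finrank ℚ (Submodule.span ℚ (Set.range fun k => KZ.eval (w k)))) :
    ∀ c ∈ AddSubgroup.closure (Set.range w), KZ.eval c = 0 → c ∈ KZ.relations :=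
  (sectorKernel_iff_finrank_eq w).2 (le_antisymm h (finrank_span_eval_le w))

/-! ### Certificate arithmetic -/

/-- **Move certificates bound the formal rank**: if `r` integer relations `Σ_k ρ_j k • w k ∈
KZ.relations` among `N = card κ` generators are `ℚ`-linearly independent as coefficient vectors,
then `finrank F(w) + r ≤ N` (rank–nullity for `(κ → ℚ) → P_ℚ`, `e_k ↦ ψ (w k)`, whose kernel
contains the `r` vectors). [Kontsevich–Zagier 2001, §1.2] -/
theorem finrank_span_add_le_card_of_relations {κ : Type*} [Fintype κ] (w : κ → KZ.FormalRep) {r : ℕ}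
    (ρ : Fin r → κ → ℤ) (hρ : LinearIndependent ℚ fun j => fun k => (ρ j k : ℚ))
    (hrel : ∀ j, ∑ k, ρ j k • w k ∈ KZ.relations) :
    finrank ℚ (Submodule.span ℚ (Set.range fun k => KZ.toPeriodAlgebra (KZ.toFormalPeriod (w k)))) + r ≤
      Fintype.card κ := by
  classical
  obtain ⟨ψ, hψ⟩ := exists_psi
  -- `Φ : (κ → ℚ) → P_ℚ`, `e_k ↦ ψ (w k)`; its range is `F(w)`
  set Φ : (κ → ℚ) →ₗ[ℚ] KZ.FormalPeriodAlgebra :=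
    Fintype.linearCombination ℚ fun k => KZ.toPeriodAlgebra (KZ.toFormalPeriod (w k)) with hΦ
  have hrange : LinearMap.range Φ =
      Submodule.span ℚ (Set.range fun k => KZ.toPeriodAlgebra (KZ.toFormalPeriod (w k))) := by
    rw [hΦ, Fintype.range_linearCombination]
  -- the certificate vectors lie in `ker Φ`
  have hker : ∀ j, (fun k => (ρ j k : ℚ)) ∈ LinearMap.ker Φ := fun j => by
    rw [LinearMap.mem_ker, hΦ, Fintype.linearCombination_apply]
    have h := toPeriodAlgebra_toFormalPeriod_eq_zero_iff.mpr (hrel j)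
    rw [← hψ, map_sum] at h
    rw [← h]
    exact Finset.sum_congr rfl fun k _ => by rw [map_zsmul, Int.cast_smul_eq_zsmul, hψ]
  -- `r ≤ finrank (ker Φ)`
  have hρ' : LinearIndependent ℚ fun j => (⟨fun k => (ρ j k : ℚ), hker j⟩ : LinearMap.ker Φ) :=
    LinearIndependent.of_comp (LinearMap.ker Φ).subtype (by exact hρ)
  have hr : r ≤ finrank ℚ (LinearMap.ker Φ) := by
    simpa using hρ'.fintype_card_le_finrank
  have hrn := LinearMap.finrank_range_add_finrank_ker Φ
  rw [hrange, Module.finrank_fintype_fun_eq_card] at hrn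
  omega

/-- **Conjecture 1 on a sector from a certificate and a dimension bound**: move rank `≥ r` (`r`
independent integer relations that are move chains), numerical rank `≥ d` (transcendence input) and
`N ≤ r + d` give the crux on `⟨w⟩` (then `finrank F(w) = finrank V(w) = d = N − r`) — the shape of every
sector theorem feeding the crux (OctahedralSymmetry, FurushoPentagon, …). [Kontsevich–Zagier 2001, §1.2] -/
theorem sectorKernel_of_certificate {κ : Type*} [Fintype κ] (w : κ → KZ.FormalRep) {r d : ℕ}
    (ρ : Fin r → κ → ℤ) (hρ : LinearIndependent ℚ fun j => fun k => (ρ j k : ℚ))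
    (hrel : ∀ j, ∑ k, ρ j k • w k ∈ KZ.relations)
    (hd : d ≤ finrank ℚ (Submodule.span ℚ (Set.range fun k => KZ.eval (w k))))
    (hN : Fintype.card κ ≤ r + d) :
    ∀ c ∈ AddSubgroup.closure (Set.range w), KZ.eval c = 0 → c ∈ KZ.relations := by
  have h := finrank_span_add_le_card_of_relations w ρ hρ hrel
  exact sectorKernel_of_finrank_le w (by omega)

/-! ### The crux is the conjunction of its finite sectors -/

/-- **`KernelForm` ⟺ formal rank = numerical rank on every finite set of formal combinations.**
(→) is the rank form on the sector generated by `S`; (←) with `S = {c}`.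
[Kontsevich–Zagier 2001, §1.2, Conjecture 1] -/
theorem kernelForm_iff_forall_finset :
    Summit.KontsevichZagierPeriods.KontsevichZagierPeriods.Theses.VietaFibre.KernelForm ↔
      ∀ S : Finset KZ.FormalRep,
        finrank ℚ (Submodule.span ℚ (Set.range fun c : S => KZ.toPeriodAlgebra (KZ.toFormalPeriod c.1))) =
          finrank ℚ (Submodule.span ℚ (Set.range fun c : S => KZ.eval c.1)) := by
  unfold Summit.KontsevichZagierPeriods.KontsevichZagierPeriods.Theses.VietaFibre.KernelForm
  constructor
  · intro hK S
    exact (sectorKernel_iff_finrank_eq (fun c : S => c.1)).1 fun c _ hc => hK c hc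
  · intro h c hc
    have hS := (sectorKernel_iff_finrank_eq (fun d : ({c} : Finset KZ.FormalRep) => d.1)).2 (h {c})
    exact hS c (AddSubgroup.subset_closure ⟨⟨c, Finset.mem_singleton_self c⟩, rfl⟩) hc

/-- **`KernelForm` ⟺ Conjecture 1 on every finitely generated sector.** [Kontsevich–Zagier 2001, §1.2] -/
theorem kernelForm_iff_forall_sector :
    Summit.KontsevichZagierPeriods.KontsevichZagierPeriods.Theses.VietaFibre.KernelForm ↔
      ∀ S : Finset KZ.FormalRep, ∀ c ∈ AddSubgroup.closure (S : Set KZ.FormalRep),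
        KZ.eval c = 0 → c ∈ KZ.relations := by
  unfold Summit.KontsevichZagierPeriods.KontsevichZagierPeriods.Theses.VietaFibre.KernelForm
  exact ⟨fun hK S c _ hc => hK c hc,
    fun h c hc => h {c} c (AddSubgroup.subset_closure (Finset.mem_singleton_self c)) hc⟩

/-- Under `KernelForm`, for every family of formal combinations, `ℚ`-linear independence of the
values ⟺ `ℚ`-linear independence of the formal classes in `P_ℚ`. [Kontsevich–Zagier 2001, §4.1] -/
theorem linearIndependent_eval_iff_of_kernelForm
    (hK : Summit.KontsevichZagierPeriods.KontsevichZagierPeriods.Theses.VietaFibre.KernelForm)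
    {κ : Type*} (w : κ → KZ.FormalRep) :
    LinearIndependent ℚ (fun k => KZ.eval (w k)) ↔
      LinearIndependent ℚ fun k => KZ.toPeriodAlgebra (KZ.toFormalPeriod (w k)) :=
  linearIndependent_eval_iff_of_sectorKernel w fun c _ hc => hK c hc

/-! ### Twins for route OctahedralSymmetry's name of the crux (same term) -/

/-- `OctahedralSymmetry.KernelForm` ⟺ formal rank = numerical rank on every finite set of formal
combinations. [Kontsevich–Zagier 2001, §1.2, Conjecture 1] -/
theorem octahedralSymmetry_kernelForm_iff_forall_finset :
    Summit.KontsevichZagierPeriods.KontsevichZagierPeriods.Theses.OctahedralSymmetry.KernelForm ↔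
      ∀ S : Finset KZ.FormalRep,
        finrank ℚ (Submodule.span ℚ (Set.range fun c : S => KZ.toPeriodAlgebra (KZ.toFormalPeriod c.1))) =
          finrank ℚ (Submodule.span ℚ (Set.range fun c : S => KZ.eval c.1)) :=
  kernelForm_iff_forall_finset

/-- `OctahedralSymmetry.KernelForm` ⟺ Conjecture 1 on every finitely generated sector.
[Kontsevich–Zagier 2001, §1.2] -/
theorem octahedralSymmetry_kernelForm_iff_forall_sector :
    Summit.KontsevichZagierPeriods.KontsevichZagierPeriods.Theses.OctahedralSymmetry.KernelForm ↔
      ∀ S : Finset KZ.FormalRep, ∀ c ∈ AddSubgroup.closure (S : Set KZ.FormalRep),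
        KZ.eval c = 0 → c ∈ KZ.relations :=
  kernelForm_iff_forall_sector

end Summit.KontsevichZagierPeriods.KernelForm.LocaliseAtValuePrime

end
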